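import Summits.NavierStokesRegularity.NavierStokesRegularity.Theorems.ArgmaxDoorsNearEngine
import Summits.NavierStokesRegularity.NavierStokesRegularity.Theorems.IntenseSetDoorsAssemblyTools
import Literature.Analysis.FluidPDE.BKMClassVorticityTimeLipschitz
import Literature.Analysis.FluidPDE.NSFiniteEnergySmoothProofs
import HarnessLib

/-!
# ArgmaxDoorsNearEngineWeighted — S35 near-field tools with a TIME-DEPENDENT far-field weight `k(s)`
# (shrinking balls `r₀(T−t)^β`, `β < 1/3`: `k(s) ∝ (T−s)^{−3β/2}`); text-independent

Companions of `ArgmaxDoorsNearEngine` (constant `k`) for nsreg-p1 g30's ROUND-34 §A «ArgmaxNearDoors» with the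
ball radius `r₀(T−t)^β`: the far-field rate is `k(s)‖ω(s)‖_{L²}` with `k` continuous on the closed slab.

* `exists_dissipation_budget_weighted` — ∃ universal `C ≥ 0`: for `k ≥ 0` continuous on `[0,L]`,
  `∫₀ᵗ k‖ω‖_{L²} ≤ √(∫₀ᵗ k²)·√(C‖u(0)‖²_{L²}/ν)` (Cauchy–Schwarz in time + Tao's energy bound);
* `norm_curl_le_barrier_exp_of_argmax_rate_le_weighted` — rate `≤ a/(T−s) + k(s)‖ω(s)‖_{L²}` at critical
  argmaxima (`a ≤ 1`) ⇒ `|ω(s,x)| ≤ (ε/(T−s) + c(T−s)^{−a})·exp(∫₀ˢ k‖ω‖_{L²})`.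

HONEST FRAME / WHAT THIS IS NOT: tools for regularity CRITERIA about hypothetical blow-up (S-door lane, LEAD
ns-s30-p1 g3, `--supports stmt-NavierStokesRegularity-0056 --as helper`); item 0056 `NoTypeII` and NS
regularity are NOT proved; no Literature fact is taken as a hypothesis; nothing here is a route or a summit
statement.
-/

noncomputable section

set_option linter.dupNamespace false

open MeasureTheory Set Function Filter Metric Real InnerProductSpace
open _root_.Topology
open scoped ENNReal NNReal RealInnerProductSpace ContDiff
open Literature.Analysis Literature.Analysis.FluidPDE
open Literature.Analysis.FluidPDE.VorticityDirectionDynamics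

namespace Summit.NavierStokesRegularity.NavierStokesRegularity.Theorems.ArgmaxDoors

-- nested operator types
set_option maxSynthPendingDepth 3

/-! ### §1 The weighted dissipation budget -/

/-- **Dissipation budget** (Leray's energy inequality read for the argmax engine). There is a universal
`C ≥ 0` such that for every classical unforced Navier–Stokes solution on a closed slab `[0,L] × ℝ³` with all
`L²` Sobolev seminorms bounded (`ν > 0`): for every `t ∈ [0,L]`,
`∫₀ᵗ ‖ω(s)‖_{L²} ds ≤ √t · √(C‖u(0)‖²_{L²}/ν)` (`|ω|² ≤ κ²|∇u|²_F`, Tao's energy bound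
`ν∫∫|∇u|²_F ≤ C_T‖u(0)‖²`, Cauchy–Schwarz in time). [cite: Tao2011, Thm. 5.4 (energy estimate);
folklore] -/
theorem exists_dissipation_budget_weighted : ∃ C : ℝ, 0 ≤ C ∧
    ∀ ⦃ν L : ℝ⦄ (_ : 0 < ν) (_ : 0 < L)
      ⦃v : ℝ → (EuclideanSpace ℝ (Fin 3)) → (EuclideanSpace ℝ (Fin 3))⦄
      ⦃q : ℝ → (EuclideanSpace ℝ (Fin 3)) → ℝ⦄ (_ : IsClassicalNSSolutionOn (Icc 0 L) ν 0 v q)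
      (_ : HasBoundedSobolevNormsOn (Icc 0 L) v) ⦃k : ℝ → ℝ⦄ (_ : ContinuousOn k (Icc 0 L))
      (_ : ∀ s ∈ Icc 0 L, 0 ≤ k s) ⦃t : ℝ⦄ (_ : t ∈ Icc 0 L),
      ∫ s in (0 : ℝ)..t, k s * (eLpNorm (curl (v s)) 2 volume).toReal ≤
        Real.sqrt (∫ s in (0 : ℝ)..t, k s ^ 2) * Real.sqrt (C * (∫ y, ‖v 0 y‖ ^ 2) / ν) := by
  obtain ⟨CT, hCTtop, hTao⟩ := tao_finite_energy_smooth_energy_bound_holds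
  set κ : ℝ := ‖curlCLM‖ with hκ
  refine ⟨κ ^ 2 * CT.toReal, by positivity, ?_⟩
  intro ν L hν hL v q hS hB k hkc hk0 t ht
  have hsm : ∀ s ∈ Icc 0 L, ContDiff ℝ ∞ (v s) := fun s hs => hS.contDiff_velocity hs
  -- the slices: `ω(s)` continuous and square integrable, `ψ(s) = ‖ω(s)‖₂ = √∫|ω(s)|²`
  obtain ⟨B₁, B₂, -, -, hpk⟩ := IntenseSetDoors.slice_package hS hB
  set ψ : ℝ → ℝ := fun s => (eLpNorm (curl (v s)) 2 volume).toReal with hψ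
  have hψc : ContinuousOn ψ (Icc 0 L) := by
    have h := hS.continuousOn_toReal_eLpNorm_curl hB hL (n := 2) le_rfl
    simpa using h
  have hIω : ∀ s ∈ Icc 0 L, Integrable fun x => ‖curl (v s) x‖ ^ 2 := by
    intro s hs
    obtain ⟨hv3, -, -, i1, -, -, -⟩ := hpk s hs
    refine (i1.const_mul (κ ^ 2)).mono'
      (((continuous_curl (hv3.of_le (by norm_cast))).norm.pow 2).aestronglyMeasurable)
      (Eventually.of_forall fun x => ?_)
    rw [Real.norm_of_nonneg (sq_nonneg _), ← mul_pow]
    exact pow_le_pow_left₀ (norm_nonneg _) (norm_curl_le (v s) x) 2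
  have hψeq : ∀ s ∈ Icc 0 L, ψ s = Real.sqrt (∫ x, ‖curl (v s) x‖ ^ 2) := by
    intro s hs
    obtain ⟨hv3, -, -, -, -, -, -⟩ := hpk s hs
    exact toReal_eLpNorm_two_eq_sqrt (continuous_curl (hv3.of_le (by norm_cast))) (hIω s hs)
  have hψ0 : ∀ s ∈ Icc 0 L, 0 ≤ ψ s := fun s _ => ENNReal.toReal_nonneg
  -- `ψ(s)² ≤ κ² ∫ |∇v(s)|²_F`, in `ℝ≥0∞` form
  have hψsq : ∀ s ∈ Icc 0 L, ENNReal.ofReal (ψ s ^ 2) ≤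
      ENNReal.ofReal (κ ^ 2) * ∫⁻ x, ENNReal.ofReal (frobeniusNormSq (fderiv ℝ (v s) x)) := by
    intro s hs
    obtain ⟨hv3, -, -, i1, -, -, -⟩ := hpk s hs
    have hv2 : ContDiff ℝ 2 (v s) := hv3.of_le (by norm_cast)
    have Ifv : Integrable fun x => frobeniusNormSq (fderiv ℝ (v s) x) := by
      refine (i1.const_mul 3).mono'
        (continuous_frobeniusNormSq_fderiv hv2 (by norm_num)).aestronglyMeasurable
        (Eventually.of_forall fun x => ?_)
      rw [Real.norm_of_nonneg (frobeniusNormSq_nonneg _)]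
      exact frobeniusNormSq_le_three_mul _
    rw [hψeq s hs, Real.sq_sqrt (integral_nonneg fun x => sq_nonneg _),
      ofReal_integral_eq_lintegral_ofReal (hIω s hs) (Eventually.of_forall fun x => sq_nonneg _),
      ← lintegral_const_mul' _ _ ENNReal.ofReal_ne_top]
    refine lintegral_mono fun x => ?_
    rw [← ENNReal.ofReal_mul (sq_nonneg _)]
    refine ENNReal.ofReal_le_ofReal ?_
    calc ‖curl (v s) x‖ ^ 2 ≤ (κ * ‖fderiv ℝ (v s) x‖) ^ 2 :=
          pow_le_pow_left₀ (norm_nonneg _) (norm_curl_le (v s) x) 2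
      _ = κ ^ 2 * ‖fderiv ℝ (v s) x‖ ^ 2 := by ring
      _ ≤ κ ^ 2 * frobeniusNormSq (fderiv ℝ (v s) x) :=
          mul_le_mul_of_nonneg_left (sq_opNorm_le_frobeniusNormSq _) (sq_nonneg _)
  -- Tao's energy bound on the slab
  have hE : ∃ A : ℝ≥0∞, A < ⊤ ∧ ∀ s ∈ Icc 0 L, ∫⁻ x, ‖v s x‖ₑ ^ 2 ≤ A := by
    obtain ⟨C0, hC0⟩ := hB 0
    refine ⟨C0, ENNReal.coe_lt_top, fun s hs => ?_⟩
    refine le_trans (le_of_eq (lintegral_congr fun x => ?_)) (hC0 s hs)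
    rw [← ofReal_norm, ← ofReal_norm, norm_iteratedFDeriv_zero]
  obtain ⟨-, hdiss⟩ := hTao ν L hν hL v q hS hE
  set E0e : ℝ≥0∞ := ∫⁻ x, ‖v 0 x‖ₑ ^ 2 with hE0e
  have hI0 : Integrable fun x => ‖v 0 x‖ ^ 2 := by
    obtain ⟨-, -, i0, -, -, -, -⟩ := hpk 0 ⟨le_rfl, hL.le⟩
    exact i0
  have hE0eq : E0e = ENNReal.ofReal (∫ y, ‖v 0 y‖ ^ 2) := by
    rw [hE0e, ofReal_integral_eq_lintegral_ofReal hI0 (Eventually.of_forall fun x => sq_nonneg _)]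
    refine lintegral_congr fun x => ?_
    rw [← ofReal_norm, ENNReal.ofReal_pow (norm_nonneg _)]
  have hE0top : E0e ≠ ⊤ := by rw [hE0eq]; exact ENNReal.ofReal_ne_top
  set Diss : ℝ≥0∞ := ∫⁻ s in Ioo 0 L, ∫⁻ x, ENNReal.ofReal (frobeniusNormSq (fderiv ℝ (v s) x))
    with hDiss
  have hDiss_le : Diss ≤ CT * E0e / ENNReal.ofReal ν := by
    rw [ENNReal.le_div_iff_mul_le (Or.inl (ENNReal.ofReal_pos.2 hν).ne')
      (Or.inl ENNReal.ofReal_ne_top), mul_comm]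
    exact hdiss
  have hDisstop : Diss ≠ ⊤ :=
    ne_top_of_le_ne_top (ENNReal.div_ne_top (ENNReal.mul_ne_top hCTtop.ne hE0top)
      (ENNReal.ofReal_pos.2 hν).ne') hDiss_le
  -- `∫₀ᵗ ψ² ≤ κ² C_T ‖v 0‖² / ν`
  have ht0 : 0 ≤ t := ht.1
  have hψ2c : ContinuousOn (fun s => ψ s ^ 2) (Icc 0 L) := hψc.pow 2
  have hint2 : ∫ s in (0 : ℝ)..t, ψ s ^ 2 ≤ κ ^ 2 * CT.toReal * (∫ y, ‖v 0 y‖ ^ 2) / ν := by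
    rw [intervalIntegral.integral_of_le ht0]
    have hmeas : AEStronglyMeasurable (fun s => ψ s ^ 2) (volume.restrict (Ioc 0 t)) :=
      (hψ2c.mono (Ioc_subset_Icc_self.trans (Icc_subset_Icc_right ht.2))).aestronglyMeasurable
        measurableSet_Ioc
    rw [integral_eq_lintegral_of_nonneg_ae (Eventually.of_forall fun s => sq_nonneg _) hmeas]
    have hle : ∫⁻ s in Ioc 0 t, ENNReal.ofReal (ψ s ^ 2) ≤ ENNReal.ofReal (κ ^ 2) * Diss := by
      rw [← restrict_Ioo_eq_restrict_Ioc]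
      calc ∫⁻ s in Ioo 0 t, ENNReal.ofReal (ψ s ^ 2)
          ≤ ∫⁻ s in Ioo 0 t, ENNReal.ofReal (κ ^ 2) *
              ∫⁻ x, ENNReal.ofReal (frobeniusNormSq (fderiv ℝ (v s) x)) :=
            setLIntegral_mono' measurableSet_Ioo fun s hs =>
              hψsq s ⟨hs.1.le, hs.2.le.trans ht.2⟩
        _ ≤ ∫⁻ s in Ioo 0 L, ENNReal.ofReal (κ ^ 2) *
              ∫⁻ x, ENNReal.ofReal (frobeniusNormSq (fderiv ℝ (v s) x)) :=
            lintegral_mono_set (Ioo_subset_Ioo le_rfl ht.2)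
        _ = ENNReal.ofReal (κ ^ 2) * Diss := by
            rw [hDiss, lintegral_const_mul' _ _ ENNReal.ofReal_ne_top]
    have hfin : ENNReal.ofReal (κ ^ 2) * Diss ≠ ⊤ := ENNReal.mul_ne_top ENNReal.ofReal_ne_top hDisstop
    calc (∫⁻ s in Ioc 0 t, ENNReal.ofReal (ψ s ^ 2)).toReal ≤ (ENNReal.ofReal (κ ^ 2) * Diss).toReal :=
          ENNReal.toReal_mono hfin hle
      _ ≤ (ENNReal.ofReal (κ ^ 2) * (CT * E0e / ENNReal.ofReal ν)).toReal :=
          ENNReal.toReal_mono (ENNReal.mul_ne_top ENNReal.ofReal_ne_top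
            (ENNReal.div_ne_top (ENNReal.mul_ne_top hCTtop.ne hE0top) (ENNReal.ofReal_pos.2 hν).ne'))
            (mul_le_mul' le_rfl hDiss_le)
      _ = κ ^ 2 * CT.toReal * (∫ y, ‖v 0 y‖ ^ 2) / ν := by
          rw [ENNReal.toReal_mul, ENNReal.toReal_div, ENNReal.toReal_mul, hE0eq,
            ENNReal.toReal_ofReal (sq_nonneg _), ENNReal.toReal_ofReal hν.le,
            ENNReal.toReal_ofReal (integral_nonneg fun y => sq_nonneg _)]
          ring
  -- Cauchy–Schwarz in time: `∫₀ᵗ kψ ≤ √(∫₀ᵗ k²) √(∫₀ᵗ ψ²)`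
  have hcs : ∫ s in (0 : ℝ)..t, k s * ψ s ≤
      Real.sqrt (∫ s in (0 : ℝ)..t, k s ^ 2) * Real.sqrt (∫ s in (0 : ℝ)..t, ψ s ^ 2) := by
    rw [intervalIntegral.integral_of_le ht0, intervalIntegral.integral_of_le ht0,
      intervalIntegral.integral_of_le ht0]
    haveI : IsFiniteMeasure (volume.restrict (Ioc (0 : ℝ) t)) := by
      refine ⟨by rw [Measure.restrict_apply_univ, Real.volume_Ioc]; exact ENNReal.ofReal_lt_top⟩
    obtain ⟨M, hM⟩ := (isCompact_Icc (a := (0 : ℝ)) (b := L)).exists_bound_of_continuousOn hψc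
    obtain ⟨Mk, hMk⟩ := (isCompact_Icc (a := (0 : ℝ)) (b := L)).exists_bound_of_continuousOn hkc
    have hsub : Ioc (0 : ℝ) t ⊆ Icc 0 L := Ioc_subset_Icc_self.trans (Icc_subset_Icc_right ht.2)
    have hψm : AEStronglyMeasurable ψ (volume.restrict (Ioc 0 t)) :=
      (hψc.mono hsub).aestronglyMeasurable measurableSet_Ioc
    have hkm : AEStronglyMeasurable k (volume.restrict (Ioc 0 t)) :=
      (hkc.mono hsub).aestronglyMeasurable measurableSet_Ioc
    have hψmem : MemLp ψ (ENNReal.ofReal 2) (volume.restrict (Ioc 0 t)) := by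
      refine (memLp_top_of_bound hψm M ?_).mono_exponent le_top
      exact (ae_restrict_iff' measurableSet_Ioc).2 (Eventually.of_forall fun s hs => hM s (hsub hs))
    have hkmem : MemLp k (ENNReal.ofReal 2) (volume.restrict (Ioc 0 t)) := by
      refine (memLp_top_of_bound hkm Mk ?_).mono_exponent le_top
      exact (ae_restrict_iff' measurableSet_Ioc).2 (Eventually.of_forall fun s hs => hMk s (hsub hs))
    have hHC : (2 : ℝ).HolderConjugate 2 :=
      { inv_add_inv_eq_inv := by norm_num
        left_pos := by norm_num
        right_pos := by norm_num }
    have hH := integral_mul_le_Lp_mul_Lq_of_nonneg (μ := volume.restrict (Ioc 0 t)) hHC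
      ((ae_restrict_iff' measurableSet_Ioc).2 (Eventually.of_forall fun s hs => hk0 s (hsub hs)))
      ((ae_restrict_iff' measurableSet_Ioc).2 (Eventually.of_forall fun s hs =>
        hψ0 s (hsub hs))) hkmem hψmem
    have hone : (∫ s in Ioc 0 t, k s ^ (2 : ℝ)) ^ (1 / (2 : ℝ)) = Real.sqrt (∫ s in Ioc 0 t, k s ^ 2) := by
      rw [Real.sqrt_eq_rpow]
      congr 1
      exact integral_congr_ae (Eventually.of_forall fun s => by simp)
    have htwo : (∫ s in Ioc 0 t, ψ s ^ (2 : ℝ)) ^ (1 / (2 : ℝ)) = Real.sqrt (∫ s in Ioc 0 t, ψ s ^ 2) := by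
      rw [Real.sqrt_eq_rpow]
      congr 1
      exact integral_congr_ae (Eventually.of_forall fun s => by simp)
    calc ∫ s in Ioc 0 t, k s * ψ s
        ≤ (∫ s in Ioc 0 t, k s ^ (2 : ℝ)) ^ (1 / (2 : ℝ)) *
            (∫ s in Ioc 0 t, ψ s ^ (2 : ℝ)) ^ (1 / (2 : ℝ)) := hH
      _ = Real.sqrt (∫ s in Ioc 0 t, k s ^ 2) * Real.sqrt (∫ s in Ioc 0 t, ψ s ^ 2) := by rw [hone, htwo]
  calc ∫ s in (0 : ℝ)..t, k s * ψ s
      ≤ Real.sqrt (∫ s in (0 : ℝ)..t, k s ^ 2) * Real.sqrt (∫ s in (0 : ℝ)..t, ψ s ^ 2) := hcs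
    _ ≤ Real.sqrt (∫ s in (0 : ℝ)..t, k s ^ 2) *
          Real.sqrt (κ ^ 2 * CT.toReal * (∫ y, ‖v 0 y‖ ^ 2) / ν) :=
        mul_le_mul_of_nonneg_left (Real.sqrt_le_sqrt hint2) (Real.sqrt_nonneg _)

/-! ### §2 The near-field engine with a time-dependent far-field weight -/

/-- **E♭ «NearEngine».** In the S-door frame on a closed slab `[0,L] × ℝ³` with `L < T`, `ν > 0`: let
`a ≤ 1`, `ε > 0`, `c, k ≥ 0`. Suppose that at every `s ∈ (0,L]` and every global vorticity argmax `x̄` on a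
CRITICAL time, `ε < (T−s)|ω(s,x̄)|`, the twist-credited rate obeys
`α(s,x̄) − ν|∇ξ(s,x̄)|²_F ≤ a/(T−s) + k‖ω(s)‖_{L²}` (the shape delivered by the local depletion D♭: near
field charged to the door, far field to the enstrophy), and `|ω(0,·)| ≤ ε/T + cT^{−a}`. Then on the slab
`|ω(s,x)| ≤ (ε/(T−s) + c(T−s)^{−a})·exp(k∫₀ˢ‖ω(r)‖_{L²}dr)`. Proof: `B = B₀e^{kΨ}`,
`B₀ = ε/(T−s) + c(T−s)^{−a}`, `Ψ = ∫₀ˢ‖ω‖_{L²}` (FTC on the continuous rate, clamped to the slab), is a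
supersolution of `y' = (a/(T−s) + k‖ω(s)‖_{L²})y` (`B₀' ≥ (a/(T−s))B₀` as `a ≤ 1`), `B ≥ ε/(T−s)`, so
`norm_curl_le_supersolution_of_argmax_rate_le` applies. [folklore] -/
theorem norm_curl_le_barrier_exp_of_argmax_rate_le_weighted {ν L T a ε c : ℝ} (hν : 0 < ν)
    (hL : 0 < L) (hLT : L < T) (ha : a ≤ 1) (hε : 0 < ε) (hc : 0 ≤ c)
    {k : ℝ → ℝ} (hkc : ContinuousOn k (Icc 0 L)) (hk : ∀ s ∈ Icc 0 L, 0 ≤ k s)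
    {v : ℝ → (EuclideanSpace ℝ (Fin 3)) → (EuclideanSpace ℝ (Fin 3))}
    {q : ℝ → (EuclideanSpace ℝ (Fin 3)) → ℝ} (hS : IsClassicalNSSolutionOn (Icc 0 L) ν 0 v q)
    (hB : HasBoundedSobolevNormsOn (Icc 0 L) v)
    (hrate : ∀ s ∈ Icc 0 L, 0 < s → ∀ x₀ : EuclideanSpace ℝ (Fin 3),
      (∀ x, ‖curl (v s) x‖ ≤ ‖curl (v s) x₀‖) → ε < (T - s) * ‖curl (v s) x₀‖ →
      ⟪vorticityDirection (curl (v s)) x₀, fderiv ℝ (v s) x₀ (vorticityDirection (curl (v s)) x₀)⟫ -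
          ν * frobeniusNormSq (fderiv ℝ (vorticityDirection (curl (v s))) x₀) ≤
        a / (T - s) + k s * (eLpNorm (curl (v s)) 2 volume).toReal)
    (hM : ∀ x, ‖curl (v 0) x‖ ≤ ε / T + c * T ^ (-a)) :
    ∀ s ∈ Icc 0 L, ∀ x, ‖curl (v s) x‖ ≤ (ε / (T - s) + c * (T - s) ^ (-a)) *
      Real.exp (∫ r in (0 : ℝ)..s, k r * (eLpNorm (curl (v r)) 2 volume).toReal) := by
  have hT : 0 < T := hL.trans hLT
  have hτ : ∀ s ∈ Icc (0 : ℝ) L, 0 < T - s := fun s hs => by linarith [hs.2]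
  -- the continuous rate `ψ`, clamped to the slab
  set ψ : ℝ → ℝ := fun s => (eLpNorm (curl (v s)) 2 volume).toReal with hψ
  have hψc : ContinuousOn ψ (Icc 0 L) := by
    have h := hS.continuousOn_toReal_eLpNorm_curl hB hL (n := 2) le_rfl
    simpa using h
  have hψ0 : ∀ s, 0 ≤ ψ s := fun s => ENNReal.toReal_nonneg
  set cl : ℝ → ℝ := fun s => max 0 (min s L) with hcl
  have hclc : Continuous cl := continuous_const.max (continuous_id.min continuous_const)
  have hclmem : ∀ s, cl s ∈ Icc 0 L := fun s =>
    ⟨le_max_left _ _, max_le hL.le (min_le_right _ _)⟩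
  have hcl_id : ∀ s ∈ Icc 0 L, cl s = s := fun s hs => by
    rw [hcl]; simp only; rw [min_eq_left hs.2, max_eq_right hs.1]
  set ψt : ℝ → ℝ := fun s => k (cl s) * ψ (cl s) with hψt
  have hψtc : Continuous ψt := (hkc.comp_continuous hclc hclmem).mul (hψc.comp_continuous hclc hclmem)
  have hψt_eq : ∀ s ∈ Icc 0 L, ψt s = k s * ψ s := fun s hs => by simp only [hψt, hcl_id s hs]
  have hψt0 : ∀ s, 0 ≤ ψt s := fun s => mul_nonneg (hk _ (hclmem s)) (hψ0 _)
  -- its primitive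
  set Ψ : ℝ → ℝ := fun s => ∫ r in (0 : ℝ)..s, ψt r with hΨ
  have hΨd : ∀ s, HasDerivAt Ψ (ψt s) s := fun s =>
    intervalIntegral.integral_hasDerivAt_right (hψtc.intervalIntegrable _ _)
      (hψtc.stronglyMeasurableAtFilter _ _) hψtc.continuousAt
  have hΨc : Continuous Ψ := continuous_iff_continuousAt.2 fun s => (hΨd s).continuousAt
  have hΨ0 : ∀ s, 0 ≤ s → 0 ≤ Ψ s := fun s hs =>
    intervalIntegral.integral_nonneg hs fun r _ => hψt0 r
  have hΨeq : ∀ s ∈ Icc 0 L, Ψ s = ∫ r in (0 : ℝ)..s, k r * ψ r := by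
    intro s hs
    refine intervalIntegral.integral_congr fun r hr => ?_
    rw [uIcc_of_le hs.1] at hr
    exact hψt_eq r ⟨hr.1, hr.2.trans hs.2⟩
  -- the barrier `B = B₀ e^{kΨ}` and its derivative
  set B₀ : ℝ → ℝ := fun s => ε / (T - s) + c * (T - s) ^ (-a) with hB₀
  set B₀' : ℝ → ℝ := fun s => ε / (T - s) ^ 2 + c * (a * (T - s) ^ (-a - 1)) with hB₀'
  set Bf : ℝ → ℝ := fun s => B₀ s * Real.exp (Ψ s) with hBf
  set Bf' : ℝ → ℝ := fun s => B₀' s * Real.exp (Ψ s) + B₀ s * (ψt s * Real.exp (Ψ s))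
    with hBf'
  set φ : ℝ → ℝ := fun s => a / (T - s) + ψt s with hφ
  have hB₀pos : ∀ s ∈ Icc 0 L, 0 < B₀ s := fun s hs =>
    add_pos_of_pos_of_nonneg (div_pos hε (hτ s hs)) (mul_nonneg hc (Real.rpow_nonneg (hτ s hs).le _))
  have hB₀c : ContinuousOn B₀ (Icc 0 L) := by
    have h1 : ContinuousOn (fun s : ℝ => T - s) (Icc 0 L) := continuousOn_const.sub continuousOn_id
    exact (continuousOn_const.div h1 fun s hs => (hτ s hs).ne').add
      (continuousOn_const.mul (h1.rpow_const fun s hs => Or.inl (hτ s hs).ne'))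
  have hB₀d : ∀ s ∈ Icc 0 L, HasDerivAt B₀ (B₀' s) s := by
    intro s hs
    have hτs := hτ s hs
    have hlin : HasDerivAt (fun r : ℝ => T - r) (-1) s := by
      simpa using (hasDerivAt_id s).const_sub T
    have h1 : HasDerivAt (fun r : ℝ => ε / (T - r)) (ε / (T - s) ^ 2) s := by
      have h := (hlin.inv hτs.ne').const_mul ε
      refine h.congr_of_eventuallyEq (Eventually.of_forall fun r => by simp [div_eq_mul_inv]) |>.congr_deriv ?_
      field_simp
    have h2 : HasDerivAt (fun r : ℝ => c * (T - r) ^ (-a)) (c * (a * (T - s) ^ (-a - 1))) s := by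
      have h := (hlin.rpow_const (p := -a) (Or.inl hτs.ne')).const_mul c
      refine h.congr_deriv ?_
      ring
    exact h1.add h2
  have hB₀super : ∀ s ∈ Icc 0 L, a / (T - s) * B₀ s ≤ B₀' s := by
    intro s hs
    have hτs := hτ s hs
    simp only [hB₀, hB₀']
    have hr : (T - s) ^ (-a - 1) = (T - s) ^ (-a) * (T - s)⁻¹ := by
      rw [Real.rpow_sub hτs, Real.rpow_one, div_eq_mul_inv]
    rw [hr]
    have hkey : a / (T - s) * (ε / (T - s)) ≤ ε / (T - s) ^ 2 := by
      rw [div_mul_div_comm, ← sq, div_le_div_iff_of_pos_right (by positivity)]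
      nlinarith
    have heq : a / (T - s) * (c * (T - s) ^ (-a)) = c * (a * ((T - s) ^ (-a) * (T - s)⁻¹)) := by
      rw [div_eq_mul_inv]; ring
    rw [mul_add, heq]
    linarith
  have hEd : ∀ s, HasDerivAt (fun r => Real.exp (Ψ r)) (ψt s * Real.exp (Ψ s)) s := by
    intro s
    have h := (hΨd s).exp
    refine h.congr_deriv ?_
    ring
  have hBc : ContinuousOn Bf (Icc 0 L) :=
    hB₀c.mul (hΨc.rexp.continuousOn)
  have hBpos : ∀ s ∈ Icc 0 L, 0 < Bf s := fun s hs => mul_pos (hB₀pos s hs) (Real.exp_pos _)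
  have hBd : ∀ s ∈ Icc 0 L, HasDerivWithinAt Bf (Bf' s) (Icc 0 L) s := fun s hs =>
    ((hB₀d s hs).mul (hEd s)).hasDerivWithinAt
  have hsuper : ∀ s ∈ Icc 0 L, φ s * Bf s ≤ Bf' s := by
    intro s hs
    have hE : 0 < Real.exp (Ψ s) := Real.exp_pos _
    have h1 : a / (T - s) * B₀ s * Real.exp (Ψ s) ≤ B₀' s * Real.exp (Ψ s) :=
      mul_le_mul_of_nonneg_right (hB₀super s hs) hE.le
    simp only [hφ, hBf, hBf']
    nlinarith [h1, hE]
  -- the growth hypothesis above the barrier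
  have hgrow : ∀ s ∈ Icc 0 L, 0 < s → ∀ x₀ : EuclideanSpace ℝ (Fin 3),
      (∀ x, ‖curl (v s) x‖ ≤ ‖curl (v s) x₀‖) → Bf s < ‖curl (v s) x₀‖ →
      ⟪vorticityDirection (curl (v s)) x₀, fderiv ℝ (v s) x₀ (vorticityDirection (curl (v s)) x₀)⟫ -
          ν * frobeniusNormSq (fderiv ℝ (vorticityDirection (curl (v s))) x₀) ≤ φ s := by
    intro s hs hspos x₀ hmax hbig
    have hτs := hτ s hs
    have hB1 : ε / (T - s) ≤ Bf s := by
      have h1 : ε / (T - s) ≤ B₀ s :=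
        le_add_of_nonneg_right (mul_nonneg hc (Real.rpow_nonneg hτs.le _))
      have h2 : B₀ s ≤ Bf s := by
        have hexp : 1 ≤ Real.exp (Ψ s) := Real.one_le_exp (hΨ0 s hs.1)
        simpa [hBf] using mul_le_mul_of_nonneg_left hexp (hB₀pos s hs).le
      exact h1.trans h2
    have hεlt : ε < (T - s) * ‖curl (v s) x₀‖ := by
      have h := hB1.trans_lt hbig
      rw [div_lt_iff₀ hτs] at h
      linarith [mul_comm (T - s) ‖curl (v s) x₀‖]
    have h := hrate s hs hspos x₀ hmax hεlt
    simp only [hφ, hψt_eq s hs]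
    exact h
  have hM' : ∀ x, ‖curl (v 0) x‖ ≤ Bf 0 := by
    intro x
    have h0 : Bf 0 = ε / T + c * T ^ (-a) := by
      simp [hBf, hB₀, hΨ]
    rw [h0]; exact hM x
  have hmain := norm_curl_le_supersolution_of_argmax_rate_le hν hL hS hB hBc hBpos hBd hsuper hgrow hM'
  intro s hs x
  have h := hmain s hs x
  rw [show Bf s = (ε / (T - s) + c * (T - s) ^ (-a)) * Real.exp (Ψ s) from rfl, hΨeq s hs] at h
  exact h

end Summit.NavierStokesRegularity.NavierStokesRegularity.Theorems.ArgmaxDoors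

end
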